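import Summits.Ventures.PercRepro.S2ThirteenEightNuSeven

/-!
# PercRepro — S2: THE CASE `ν = 4` OF THE COLOOP-FREE CELL `(13, 8)`, PART (I): A RANK-`6` SET OF `13` POINTS (p7, gen 18; sub-claim S2)

The case `ν = 4` of the coloop-free cell `(13, 8)` (no set of nullity `5` on `≤ 10` points, so every set of rank `≤ 5` has `≤ 9` points
and every set of rank `≤ 4` has `≤ 8`) is split by the largest set of rank `6`. Part (I): a set `V` of nullity `7` on `≤ 13` points
exists (the nullity-`4` flat plus a parallel class of four in its contraction). The kit's hitting counts alone close it: a top `m`-set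
meets `V` in `≥ m − 1` points, `#U ≤ 49478`, `#spanning ≤ 53595`, the tail by flats at `(9, 8)` is `933221/9`, `m = 77`, ratio `0.71`.
**`c025_thirteen_eight_cf_nu_four_thirteen`**. Nothing about the cell is claimed. Axioms: standard.
-/

open scoped Matroid

namespace PercRepro

namespace ThmN

open Set

variable {α : Type}

/-- **Part (I) of the case `ν = 4` of the coloop-free cell `(13, 8)`**: a set of nullity `7` on `≤ 13` points, by the kit's hitting
counts against the tail by flats at `(9, 8)` (`#U ≤ 49478`, `#spanning ≤ 53595`, `m = 77`). -/
theorem c025_thirteen_eight_cf_nu_four_thirteen (M : Matroid α) [M.Finite]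
    (hR : M.eRank = ((13 : ℕ) : ℕ∞)) (hn : M.E.ncard = 13 + 8)
    (hfree : ∀ e ∈ M.E, ∃ A ⊆ M.E \ {e}, e ∉ M.closure A ∧ e ∉ M.closure ((M.E \ {e}) \ A)) (hK : ∀ e, ¬ M.IsColoop e)
    (h5 : ¬ ∃ W ⊆ M.E, W.ncard ≤ 10 ∧ W.encard = M.eRk W + 5)
    (hV : ∃ V ⊆ M.E, V.ncard ≤ 13 ∧ V.encard = M.eRk V + 7) : RLS M 13 5 := by
  classical
  have hd : M.E.encard = M.eRank + ((8 : ℕ) : ℕ∞) := by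
    rw [hR, ← M.ground_finite.cast_ncard_eq, hn]
    push_cast
    ring
  obtain ⟨hs3, hs4, hs5⟩ := caps_thirteen_eight_cf M hd hn hfree hK
  have hflat : ∀ X ⊆ M.E, M.eRk X ≤ 5 → X.ncard ≤ 9 := fun X hX hr => by
    have := S2.ncard_le_of_eRk_le_of_not_nullity M 5 10 (by norm_num) h5 hX (r := 5) (by norm_num) (by exact_mod_cast hr)
    omega
  have hflat' : ∀ X ⊆ M.E, M.eRk X ≤ 4 → X.ncard ≤ 8 := fun X hX hr => by
    have := S2.ncard_le_of_eRk_le_of_not_nullity M 5 10 (by norm_num) h5 hX (r := 4) (by norm_num) (by exact_mod_cast hr)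
    omega
  obtain ⟨W, hW, hWn, hWk⟩ := hV
  have full : Matroid.topCount M 13 5 ≤ ∑ m ∈ Finset.Icc 5 8, ∑ j ∈ Finset.Icc (m + 7 - 8) m,
      W.ncard.choose j * (13 + 8 - W.ncard).choose (m - j) := by
    refine (S2.topCount_le_sum_spanning M hR hd 5).trans ?_
    refine Finset.sum_le_sum (fun m _ => ?_)
    have h := S2.ncard_spanning_compl_le_of_nullity M hW hd hWk (m := m)
    rw [hn] at h
    exact h
  have hU' : Matroid.topCount M 13 5 ≤ 49478 := by
    refine full.trans ?_
    generalize W.ncard = w at hWn ⊢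
    interval_cases w <;> decide
  have hS' : {X : Set α | X ⊆ M.E ∧ M.eRk X = M.eRank}.ncard ≤ 53595 := by
    refine (S2.ncard_spanning_le_of_nullity M hW hd hWk).trans ?_
    rw [hn]
    generalize W.ncard = w at hWn ⊢
    interval_cases w <;> decide
  have hA := ncard_eRk_le_five_le_flats M 13 8 (by norm_num) hR hn hfree 9 8 hflat hflat' (by norm_num) (by norm_num)
    (by norm_num) (by norm_num) 13 85 526 hs3 hs4 hs5
  have hA' : ({X : Set α | X ⊆ M.E ∧ M.eRk X ≤ 5}.ncard : ℚ) ≤ 933221 / 9 := by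
    norm_num [Finset.sum_range_succ, Nat.choose] at hA
    linarith
  rw [RLS_iff]
  exact c025_core_five_cell_of_counts_xqictq5g M 13 8 (by norm_num) hR hn 49478 hU' _ hA' 53595 hS'
    9480 (by norm_num) (phiK 13 5) (by rw [phiK_thirteen_five]; norm_num) ⟨77, by norm_num, by norm_num, by norm_num⟩

end ThmN

end PercRepro
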